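import Summits.QuantumFields.YangMills.Theorems.ColdStartUniversalityLqFlowTools
import HarnessLib

/-!
# Route `ColdStartUniversality` (fixed-cut-off package, `Lᵖ` side): real-variable toolkit for the CONVERSE of Gross's theorem
# (hypercontractivity ⇒ log-Sobolev) — the lower half of the exponent change and the arithmetic of one lattice step

Helper file (seat `ym-line-csu-p1`, g36; `--supports stmt-QuantumFields-24809`), sequel of `…LqFlowTools`.  ABSTRACT real analysis /
integration, no SZZ object (namespace `…ColdStartUniversality.LqFlow`):
* `rpow_add_sub_ge`, `integral_rpow_add_ge` — the LOWER half of the exponent change: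
  `∫ w^q dν + ε∫ w^q log w dν − (εΛ)²∫ w^q dν ≤ ∫ w^{q+ε} dν` (`|e^x − 1 − x| ≤ x²`, `|x| ≤ 1`);
* ★ `gross_converse_step` — one lattice step of the converse in real arithmetic: hypercontractivity `A ≤ N·e^{εL/2}`
  (`A = ∫ (κ_hF)^{2+ε}`, `ε = e^{4ρh} − 1`), the lower exponent bound, `∫ (κ_hF)² = N − 2h·𝓔_{2h}(F)` and the Lipschitz comparison
  give `ρ·Ent(F²) ≤ 𝓔_{2h}(F) + R·h`.
The measure-theoretic converse is the sequel `…LatticeLangevinHypercontractivityConverse`.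

THEOREMS ONLY, no definition, no sorry.  HONEST FRAMING: pure bookkeeping for a FIXED-cut-off statement; nothing K-uniform; no crux,
rung or summit statement is proved; the Yang–Mills mass gap is NOT proved.
-/

set_option autoImplicit false

noncomputable section

namespace Summit.QuantumFields.YangMills.Theorems.ColdStartUniversality

open MeasureTheory Filter Set Topology
open scoped BigOperators NNReal ENNReal

namespace LqFlow

/-! ## §1. The lower half of the exponent change and the real arithmetic of one step -/

/-- **Moving the exponent, pointwise, lower half**: for `0 < w` with `|log w| ≤ Λ`, `0 ≤ ε`, `εΛ ≤ 1`:
`w^q + ε·(w^q log w) − w^q·(εΛ)² ≤ w^{q+ε}` (`|e^x − 1 − x| ≤ x²` for `|x| ≤ 1`). [folklore] -/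
theorem rpow_add_sub_ge {w q ε Λ : ℝ} (hw : 0 < w) (hΛ : |Real.log w| ≤ Λ) (hε : 0 ≤ ε) (hεΛ : ε * Λ ≤ 1) :
    w ^ q + ε * (w ^ q * Real.log w) - w ^ q * (ε * Λ) ^ 2 ≤ w ^ (q + ε) := by
  set x : ℝ := ε * Real.log w with hx
  have hxabs : |x| ≤ ε * Λ := by
    rw [hx, abs_mul, abs_of_nonneg hε]
    exact mul_le_mul_of_nonneg_left hΛ hε
  have hx1 : |x| ≤ 1 := hxabs.trans hεΛ
  have hexp : -((ε * Λ) ^ 2) ≤ Real.exp x - 1 - x := by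
    have h1 := Real.abs_exp_sub_one_sub_id_le hx1
    have h2 : x ^ 2 ≤ (ε * Λ) ^ 2 := by
      rw [← sq_abs x]
      exact pow_le_pow_left₀ (abs_nonneg _) hxabs 2
    linarith [neg_abs_le (Real.exp x - 1 - x)]
  have e1 : w ^ (q + ε) = w ^ q * Real.exp x := by
    rw [Real.rpow_add hw, hx, mul_comm ε (Real.log w), ← Real.rpow_def_of_pos hw]
  have hwq : 0 ≤ w ^ q := (Real.rpow_pos_of_pos hw q).le
  have e2 : w ^ q + ε * (w ^ q * Real.log w) - w ^ q * (ε * Λ) ^ 2 = w ^ q * (1 + x + -((ε * Λ) ^ 2)) := by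
    rw [hx]; ring
  rw [e2, e1]
  exact mul_le_mul_of_nonneg_left (by linarith) hwq

/-- **Lower exponent change under the integral**: for continuous `w > 0` on a compact space, `ν` finite, `|log w| ≤ Λ`, `0 ≤ ε`,
`εΛ ≤ 1`:  `∫ w^q dν + ε·∫ w^q log w dν − (εΛ)²·∫ w^q dν ≤ ∫ w^{q+ε} dν`. [folklore] -/
theorem integral_rpow_add_ge {X : Type*} [TopologicalSpace X] [CompactSpace X] [MeasurableSpace X] [OpensMeasurableSpace X]
    (ν : Measure X) [IsFiniteMeasure ν] {w : X → ℝ} (hw : Continuous w) (hpos : ∀ x, 0 < w x)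
    {q ε Λ : ℝ} (hΛ : ∀ x, |Real.log (w x)| ≤ Λ) (hε : 0 ≤ ε) (hεΛ : ε * Λ ≤ 1) :
    (∫ x, w x ^ q ∂ν) + ε * (∫ x, w x ^ q * Real.log (w x) ∂ν) - (ε * Λ) ^ 2 * ∫ x, w x ^ q ∂ν ≤ ∫ x, w x ^ (q + ε) ∂ν := by
  have hc1 : Continuous fun x => w x ^ (q + ε) := hw.rpow_const fun x => Or.inl (hpos x).ne'
  have hc2 : Continuous fun x => w x ^ q := hw.rpow_const fun x => Or.inl (hpos x).ne'
  have hc3 : Continuous fun x => w x ^ q * Real.log (w x) := hc2.mul (hw.log fun x => (hpos x).ne')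
  have bound : ∀ {f : X → ℝ}, Continuous f → Integrable f ν := by
    intro f hf
    obtain ⟨C, hC⟩ := isCompact_univ.exists_bound_of_continuousOn hf.continuousOn
    exact Integrable.of_bound hf.measurable.aestronglyMeasurable C (ae_of_all _ fun x => hC x (mem_univ x))
  have i1 := bound hc1
  have i2 := bound hc2
  have i3 := bound hc3
  have hpt : ∀ x, w x ^ q + ε * (w x ^ q * Real.log (w x)) - (ε * Λ) ^ 2 * w x ^ q ≤ w x ^ (q + ε) := by
    intro x
    have := rpow_add_sub_ge (q := q) (hpos x) (hΛ x) hε hεΛ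
    linarith
  have i5 : Integrable (fun x => ε * (w x ^ q * Real.log (w x))) ν := i3.const_mul ε
  have i4 : Integrable (fun x => (ε * Λ) ^ 2 * w x ^ q) ν := i2.const_mul _
  have i23 : Integrable (fun x => w x ^ q + ε * (w x ^ q * Real.log (w x))) ν := i2.add i5
  have ilhs : Integrable (fun x => w x ^ q + ε * (w x ^ q * Real.log (w x)) - (ε * Λ) ^ 2 * w x ^ q) ν := i23.sub i4
  have hm := integral_mono ilhs i1 hpt
  rw [integral_sub i23 i4, integral_add i2 i5, integral_const_mul, integral_const_mul] at hm
  exact hm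

/-- ★ **One step of the converse, real arithmetic only.**  With `N = ‖F‖₂² > 0`, `L = log N`, `Ent = 2X − NL ≥ 0`
(`X = ∫ F² log F`, `L` a real number — `log N` in the application), `ε = e^{4ρh} − 1 ∈ [4ρh, E₁h]`, `|εL/2| ≤ 1`: hypercontractivity `A ≤ N·e^{εL/2}` (`A = ∫ (κ_hF)^{2+ε}`), the lower
exponent bound `N_w + εX_w − (εΛ)²B₂ ≤ A`, the identity `N_w = N − 2h·Φ` (`Φ = 𝓔_{2h}(F)`) and `|X_w − X| ≤ M₁C·h` give
`ρ·Ent ≤ Φ + R·h`, `R = (E₁M₁C + E₁²Λ²B₂ + N·E₁²L²/4)/2`. [folklore] -/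
theorem gross_converse_step {N A Nw X Xw Ent L ε h ρ Φ M₁C Λ B₂ E₁ : ℝ}
    (hN : 0 < N) (hh : 0 < h) (hρ : 0 ≤ ρ) (hEnt0 : 0 ≤ Ent) (hM₁C : 0 ≤ M₁C) (hB₂ : 0 ≤ B₂)
    (hEnt : Ent = 2 * X - N * L)
    (hA : A ≤ N * Real.exp (ε * L / 2)) (hlow : Nw + ε * Xw - (ε * Λ) ^ 2 * B₂ ≤ A) (hNw : Nw = N - 2 * h * Φ)
    (hLip : |Xw - X| ≤ M₁C * h) (hεlo : 4 * ρ * h ≤ ε) (hεhi : ε ≤ E₁ * h) (hεL : |ε * L / 2| ≤ 1) :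
    ρ * Ent ≤ Φ + (E₁ * M₁C + E₁ ^ 2 * Λ ^ 2 * B₂ + N * E₁ ^ 2 * L ^ 2 / 4) / 2 * h := by
  have hε0 : 0 ≤ ε := le_trans (by positivity) hεlo
  -- `N e^{εL/2} ≤ N + NεL/2 + N(εL/2)²`
  have hexp : Real.exp (ε * L / 2) ≤ 1 + ε * L / 2 + (ε * L / 2) ^ 2 := by
    have h1 := Real.abs_exp_sub_one_sub_id_le hεL
    linarith [le_abs_self (Real.exp (ε * L / 2) - 1 - ε * L / 2)]
  have hA' : A ≤ N + N * (ε * L / 2) + N * (ε * L / 2) ^ 2 := by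
    have := mul_le_mul_of_nonneg_left hexp hN.le
    linarith
  -- `εX_w ≥ εX − εM₁Ch`
  have hεX : ε * X - ε * (M₁C * h) ≤ ε * Xw := by
    have h1 : X - M₁C * h ≤ Xw := by linarith [(abs_le.1 hLip).1]
    have := mul_le_mul_of_nonneg_left h1 hε0
    linarith
  -- the main inequality `(ε/2)·Ent ≤ 2hΦ + εM₁Ch + ε²Λ²B₂ + Nε²L²/4`
  have hmain : ε / 2 * Ent ≤ 2 * h * Φ + ε * (M₁C * h) + (ε * Λ) ^ 2 * B₂ + N * (ε * L / 2) ^ 2 := by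
    rw [hEnt]
    rw [hNw] at hlow
    linarith
  -- `ε ≤ E₁h` in the three error terms
  have hE₁h : 0 ≤ E₁ * h := hε0.trans hεhi
  have herr : ε * (M₁C * h) + (ε * Λ) ^ 2 * B₂ + N * (ε * L / 2) ^ 2 ≤
      h ^ 2 * (E₁ * M₁C + E₁ ^ 2 * Λ ^ 2 * B₂ + N * E₁ ^ 2 * L ^ 2 / 4) := by
    have h1 : ε * (M₁C * h) ≤ E₁ * h * (M₁C * h) := mul_le_mul_of_nonneg_right hεhi (mul_nonneg hM₁C hh.le)
    have hsq : ε ^ 2 ≤ (E₁ * h) ^ 2 := pow_le_pow_left₀ hε0 hεhi 2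
    have h2 : (ε * Λ) ^ 2 * B₂ ≤ (E₁ * h) ^ 2 * Λ ^ 2 * B₂ := by
      rw [mul_pow]
      exact mul_le_mul_of_nonneg_right (mul_le_mul_of_nonneg_right hsq (sq_nonneg Λ)) hB₂
    have h3 : N * (ε * L / 2) ^ 2 ≤ N * ((E₁ * h) ^ 2 * L ^ 2 / 4) := by
      refine mul_le_mul_of_nonneg_left ?_ hN.le
      have e : (ε * L / 2) ^ 2 = ε ^ 2 * L ^ 2 / 4 := by ring
      rw [e]
      have := mul_le_mul_of_nonneg_right hsq (sq_nonneg L)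
      linarith
    have e1 : E₁ * h * (M₁C * h) = h ^ 2 * (E₁ * M₁C) := by ring
    have e2 : (E₁ * h) ^ 2 * Λ ^ 2 * B₂ = h ^ 2 * (E₁ ^ 2 * Λ ^ 2 * B₂) := by ring
    have e3 : N * ((E₁ * h) ^ 2 * L ^ 2 / 4) = h ^ 2 * (N * E₁ ^ 2 * L ^ 2 / 4) := by ring
    rw [e1] at h1; rw [e2] at h2; rw [e3] at h3
    linarith
  -- `(ε/2)·Ent ≥ 2ρh·Ent`
  have hlow2 : 2 * ρ * h * Ent ≤ ε / 2 * Ent := by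
    have := mul_le_mul_of_nonneg_right hεlo hEnt0
    linarith
  -- divide by `2h`
  have hfin : 2 * h * (ρ * Ent) ≤ 2 * h * (Φ + (E₁ * M₁C + E₁ ^ 2 * Λ ^ 2 * B₂ + N * E₁ ^ 2 * L ^ 2 / 4) / 2 * h) := by
    have e : 2 * h * (Φ + (E₁ * M₁C + E₁ ^ 2 * Λ ^ 2 * B₂ + N * E₁ ^ 2 * L ^ 2 / 4) / 2 * h) =
        2 * h * Φ + h ^ 2 * (E₁ * M₁C + E₁ ^ 2 * Λ ^ 2 * B₂ + N * E₁ ^ 2 * L ^ 2 / 4) := by ring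
    rw [e]
    linarith
  exact le_of_mul_le_mul_left hfin (by positivity)

end LqFlow

end Summit.QuantumFields.YangMills.Theorems.ColdStartUniversality

end
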